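import Mathlib
import Summits.MatrixMultiplication.MatrixMultiplication.Theses.AutomaticSTPPDesigns
import Summits.MatrixMultiplication.MatrixMultiplication.Theorems.AutomaticSTPPDesignsAutomaticPackingThesisNormalForm
import Literature.Computability.AlgebraicComplexity.PrattTrapezoidValSTPP
import Literature.Computability.AlgebraicComplexity.GroupTheoreticMatMulThmBProofs

/-!
# `AutomaticPackingThesis` — the rank normal form (homocyclic hosts `(ℤ/N)^R`)

Route `MatrixMultiplication/AutomaticSTPPDesigns`, crux `stmt-MatrixMultiplication-7356`
(`AutomaticPackingThesis`), line `Sketch`, lead c3. Support file (`--supports`): it does not close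
the crux; it proves the registered stub `stub_rankBeatNormalForm` of the skeleton.

By the any-modulus normal form of the crux (`automaticPackingThesis_iff_anyModulus`, tree file
`AutomaticSTPPDesignsAutomaticPackingThesisNormalForm`), `AutomaticPackingThesis` holds iff for
every `τ > 2/3` some STPP design in some cyclic `ℤ/N`, `N ≥ 2`, has `N < ∑ᵢ (|Aᵢ||Bᵢ||Cᵢ|)^τ`.
This file proves the RANK normal form: STPP designs in homocyclic groups `(ℤ/N)^R` of any rank
`R ≥ 1` feed the crux iff they beat `3^R · N^R`, the factor `3^R` being the price of the
mixed-radix transfer to a cyclic group.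

* `exists_isSTPP_of_reflect` — an STPP design keeps the STPP and its block sizes along any map of
  abelian groups reflecting three-fold sums (`addSimultaneousTPP_image_of_reflect`,
  `injective_of_reflect`).
* `rankOneBeat_of_anyModulusBeat` (`→`): a cyclic witness `N < S` has concatenation powers
  (`concatPower`) of ratio `(S/N)^m > 3`, i.e. `3 · N^m < S^m`; read in rank `R = 1` along
  `x ↦ (fun _ => x)` this is a witness of the rank form.
* `anyModulusBeat_of_rankBeat` (`←`): the mixed-radix map `x ↦ Σⱼ xⱼ (3N)^j`
  (`exists_freiman3_pi_zmod`) reflects three-fold sums and has three-fold sums `< 3^R N^R`, so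
  reduced modulo `3^R N^R` it still reflects three-fold sums; the image family in `ℤ/(3^R N^R)` is
  STPP with the same block sizes, and `3^R N^R ≥ 2`.
* `automaticPackingThesis_iff_rankBeat` — the equivalence; `stub_rankBeatNormalForm` — the
  registered stub of the skeleton, verbatim.

## References

* K. Pratt, *On generalized corners and matrix multiplication*, ITCS 2024, arXiv:2309.03878:
  proof of Thm. 4.7, pp. 9–10 (the mixed-radix map `ℤ_{m₁} × ⋯ × ℤ_{m_k} → ℤ_{∏ 3mᵢ}` preserving
  the STPP).
* H. Cohn, R. Kleinberg, B. Szegedy, C. Umans, *Group-theoretic algorithms for matrix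
  multiplication*, FOCS 2005, arXiv:math/0511460: Def. 5.1 (STPP), Lemma 5.4, Thm. 5.5.
-/

-- single-conjunct summit: the mandated namespace repeats `MatrixMultiplication`.
set_option linter.dupNamespace false

noncomputable section

namespace Summit.MatrixMultiplication.MatrixMultiplication.Theorems

namespace AutomaticPackingThesis

open Finset Literature.Combinatorics.Additive Literature.Computability.AlgebraicComplexity
open Summit.MatrixMultiplication.MatrixMultiplication.Theses.AutomaticSTPPDesigns

/-! ### Transport along maps reflecting three-fold sums -/

/-- **Transport of an STPP design** (route predicate `IsSTPP`, `Fin n`-indexed): along a map of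
abelian groups `φ : K → K'` reflecting three-fold sums, the image family is again an STPP design,
with the same block sizes (`φ` is injective). [cite: Pratt2024, Thm. 4.7 (proof)] -/
theorem exists_isSTPP_of_reflect {K K' : Type*} [AddCommGroup K] [AddCommGroup K']
    [DecidableEq K'] {n : ℕ} {A B C : Fin n → Finset K} (hS : IsSTPP A B C) (φ : K → K')
    (hφ : ∀ a b c a' b' c', φ a + φ b + φ c = φ a' + φ b' + φ c' → a + b + c = a' + b' + c') :
    ∃ A' B' C' : Fin n → Finset K', IsSTPP A' B' C' ∧
      ∀ i, (A' i).card = (A i).card ∧ (B' i).card = (B i).card ∧ (C' i).card = (C i).card := by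
  have hinj := injective_of_reflect φ hφ
  exact ⟨fun i => (A i).image φ, fun i => (B i).image φ, fun i => (C i).image φ,
    (isSTPP_iff_addSimultaneousTPP _ _ _).2
      (addSimultaneousTPP_image_of_reflect ((isSTPP_iff_addSimultaneousTPP _ _ _).1 hS) φ hφ),
    fun i => ⟨card_image_of_injective _ hinj, card_image_of_injective _ hinj,
      card_image_of_injective _ hinj⟩⟩

/-! ### `→`: cyclic witnesses, pumped above ratio `3`, read in rank one -/

/-- **Cyclic witnesses give rank-one witnesses.** A cyclic STPP design with `N < S`,
`S = ∑ᵢ (|Aᵢ||Bᵢ||Cᵢ|)^τ`, `N ≥ 2`, has concatenation powers (`concatPower`) in `ℤ/(N^m)` with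
packing sum `S^m = (S/N)^m N^m > 3 N^m` once `(S/N)^m > 3`; along `x ↦ (fun _ => x)` into
`(ℤ/(N^m))^1` (which reflects three-fold sums: evaluate at `0`) this is an STPP design in rank
`R = 1` beating `3^1 · (N^m)^1`. [folklore] -/
theorem rankOneBeat_of_anyModulusBeat {τ : ℝ}
    (h : ∃ (N n : ℕ) (_ : 2 ≤ N) (A B C : Fin n → Finset (ZMod N)),
      IsSTPP A B C ∧ (N : ℝ) < ∑ i, (((A i).card * (B i).card * (C i).card : ℕ) : ℝ) ^ τ) :
    ∃ (N R n : ℕ) (_ : 1 ≤ N) (_ : 1 ≤ R) (A B C : Fin n → Finset (Fin R → ZMod N)),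
      IsSTPP A B C ∧
        (3 : ℝ) ^ R * (N : ℝ) ^ R < ∑ i, (((A i).card * (B i).card * (C i).card : ℕ) : ℝ) ^ τ := by
  obtain ⟨N, n, hN, A, B, C, hS, hbeat⟩ := h
  set S : ℝ := ∑ i, (((A i).card * (B i).card * (C i).card : ℕ) : ℝ) ^ τ
  have hN0 : (0 : ℝ) < (N : ℝ) := by exact_mod_cast (by omega : 0 < N)
  have hr : 1 < S / (N : ℝ) := by rwa [one_lt_div hN0]
  obtain ⟨m, hm⟩ := pow_unbounded_of_one_lt (3 : ℝ) hr
  -- read the design in `ℤ/(N^1)` and take its `m`-th concatenation power in `ℤ/(N^(1 m))`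
  obtain ⟨A₁, B₁, C₁, hS₁, hcard₁⟩ := isSTPP_transport_eq (pow_one N).symm hS
  obtain ⟨nm, Am, Bm, Cm, hSm, hsum⟩ := concatPower N 1 (by omega) n A₁ B₁ C₁ hS₁ τ m
  -- move to rank one along `x ↦ (fun _ => x)`
  obtain ⟨A', B', C', hS', hcard'⟩ := exists_isSTPP_of_reflect hSm
    (fun (x : ZMod (N ^ (1 * m))) (_ : Fin 1) => x)
    (fun a b c a' b' c' he => by simpa only [Pi.add_apply] using congr_fun he 0)
  refine ⟨N ^ (1 * m), 1, nm, Nat.one_le_pow _ _ (by omega), le_rfl, A', B', C', hS', ?_⟩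
  have hS₁sum : ∑ i, (((A₁ i).card * (B₁ i).card * (C₁ i).card : ℕ) : ℝ) ^ τ = S :=
    Finset.sum_congr rfl fun i _ => by rw [(hcard₁ i).1, (hcard₁ i).2.1, (hcard₁ i).2.2]
  have hsum' : ∑ i, (((A' i).card * (B' i).card * (C' i).card : ℕ) : ℝ) ^ τ = S ^ m := by
    rw [← hS₁sum, ← hsum]
    exact Finset.sum_congr rfl fun i _ => by rw [(hcard' i).1, (hcard' i).2.1, (hcard' i).2.2]
  rw [hsum', pow_one, pow_one, Nat.cast_pow, one_mul]
  -- `S^m = (S/N)^m N^m > 3 N^m`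
  have hSm' : S ^ m = (S / (N : ℝ)) ^ m * (N : ℝ) ^ m := by
    rw [div_pow, div_mul_cancel₀]
    exact pow_ne_zero _ hN0.ne'
  rw [hSm']
  exact mul_lt_mul_of_pos_right hm (pow_pos hN0 m)

/-! ### `←`: the mixed-radix transfer to a cyclic group -/

/-- **Rank witnesses give cyclic witnesses** (the transfer in the proof of Pratt's Thm. 4.7): the
mixed-radix map `ψ : (ℤ/N)^R → ℕ`, `x ↦ Σⱼ xⱼ (3N)^j` (`exists_freiman3_pi_zmod`), reflects
three-fold sums and has all three-fold sums `< 3^R N^R`, so `x ↦ ψ x mod 3^R N^R` still reflects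
three-fold sums; hence an STPP design in `(ℤ/N)^R` beating `3^R N^R` maps to an STPP design in the
cyclic group `ℤ/(3^R N^R)` (`3^R N^R ≥ 2` for `N, R ≥ 1`) with the same block sizes, beating its
host. [cite: Pratt2024, Thm. 4.7 (proof)] -/
theorem anyModulusBeat_of_rankBeat {τ : ℝ}
    (h : ∃ (N R n : ℕ) (_ : 1 ≤ N) (_ : 1 ≤ R) (A B C : Fin n → Finset (Fin R → ZMod N)),
      IsSTPP A B C ∧
        (3 : ℝ) ^ R * (N : ℝ) ^ R < ∑ i, (((A i).card * (B i).card * (C i).card : ℕ) : ℝ) ^ τ) :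
    ∃ (N n : ℕ) (_ : 2 ≤ N) (A B C : Fin n → Finset (ZMod N)),
      IsSTPP A B C ∧ (N : ℝ) < ∑ i, (((A i).card * (B i).card * (C i).card : ℕ) : ℝ) ^ τ := by
  obtain ⟨N, R, n, hN, hR, A, B, C, hS, hbeat⟩ := h
  have hN0 : 0 < N := by omega
  obtain ⟨ψ, h₁, h₂⟩ := exists_freiman3_pi_zmod R (fun _ => N) (fun _ => hN0)
  -- all three-fold sums of `ψ` are `< 3^R N^R`
  have h₁' : ∀ a b c, ψ a + ψ b + ψ c < 3 ^ R * N ^ R := fun a b c =>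
    (h₁ a b c).trans_eq (by rw [Fin.prod_const])
  haveI : NeZero (3 ^ R * N ^ R) := ⟨(Nat.mul_pos (pow_pos (by norm_num) R) (pow_pos hN0 R)).ne'⟩
  -- `ψ mod 3^R N^R` reflects three-fold sums
  have hφr : ∀ a b c a' b' c' : Fin R → ZMod N,
      ((ψ a : ℕ) : ZMod (3 ^ R * N ^ R)) + ((ψ b : ℕ) : ZMod (3 ^ R * N ^ R)) +
          ((ψ c : ℕ) : ZMod (3 ^ R * N ^ R)) =
        ((ψ a' : ℕ) : ZMod (3 ^ R * N ^ R)) + ((ψ b' : ℕ) : ZMod (3 ^ R * N ^ R)) +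
          ((ψ c' : ℕ) : ZMod (3 ^ R * N ^ R)) →
      a + b + c = a' + b' + c' := by
    intro a b c a' b' c' he
    apply h₂
    have he' : ((ψ a + ψ b + ψ c : ℕ) : ZMod (3 ^ R * N ^ R)) =
        ((ψ a' + ψ b' + ψ c' : ℕ) : ZMod (3 ^ R * N ^ R)) := by
      push_cast; exact he
    rwa [ZMod.natCast_eq_natCast_iff', Nat.mod_eq_of_lt (h₁' _ _ _),
      Nat.mod_eq_of_lt (h₁' _ _ _)] at he'
  obtain ⟨A', B', C', hS', hcard'⟩ := exists_isSTPP_of_reflect hS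
    (fun x : Fin R → ZMod N => ((ψ x : ℕ) : ZMod (3 ^ R * N ^ R))) hφr
  refine ⟨3 ^ R * N ^ R, n, ?_, A', B', C', hS', ?_⟩
  · -- `2 ≤ 3 ≤ 3^R ≤ 3^R N^R`
    have h3 : 2 ≤ 3 ^ R := Nat.succ_le_of_lt (Nat.one_lt_pow (by omega) (by norm_num))
    have hNR : 1 ≤ N ^ R := Nat.one_le_pow _ _ hN0
    calc 2 = 2 * 1 := rfl
      _ ≤ 3 ^ R * N ^ R := Nat.mul_le_mul h3 hNR
  · have hsum : ∑ i, (((A' i).card * (B' i).card * (C' i).card : ℕ) : ℝ) ^ τ =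
        ∑ i, (((A i).card * (B i).card * (C i).card : ℕ) : ℝ) ^ τ :=
      Finset.sum_congr rfl fun i _ => by rw [(hcard' i).1, (hcard' i).2.1, (hcard' i).2.2]
    rw [hsum]
    exact_mod_cast hbeat

/-! ### The rank normal form -/

/-- **Rank normal form of the crux.** `AutomaticPackingThesis` holds iff for every `τ > 2/3` some
STPP design in some homocyclic group `(ℤ/N)^R` (`N, R ≥ 1`) beats `3^R · N^R` at exponent `τ`:
`3^R N^R < ∑ᵢ (|Aᵢ||Bᵢ||Cᵢ|)^τ`. (`→`: the any-modulus normal form, ratio pumped above `3` by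
concatenation powers, read in rank `1`; `←`: the mixed-radix transfer to `ℤ/(3^R N^R)` and the
any-modulus normal form.) [cite: Pratt2024, Thm. 4.7 (proof)] -/
theorem automaticPackingThesis_iff_rankBeat :
    AutomaticPackingThesis ↔
      ∀ τ : ℝ, 2 / 3 < τ → ∃ (N R n : ℕ) (_ : 1 ≤ N) (_ : 1 ≤ R)
        (A B C : Fin n → Finset (Fin R → ZMod N)),
        IsSTPP A B C ∧
          (3 : ℝ) ^ R * (N : ℝ) ^ R < ∑ i, (((A i).card * (B i).card * (C i).card : ℕ) : ℝ) ^ τ := by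
  rw [automaticPackingThesis_iff_anyModulus]
  exact ⟨fun h τ hτ => rankOneBeat_of_anyModulusBeat (h τ hτ),
    fun h τ hτ => anyModulusBeat_of_rankBeat (h τ hτ)⟩

/-- Registered stub `stub_rankBeatNormalForm` of crux stmt-MatrixMultiplication-7356 (line `Sketch`,
lead c3): the crux is equivalent to its rank normal form — verbatim
`automaticPackingThesis_iff_rankBeat`. [cite: Pratt2024, Thm. 4.7 (proof)] -/
theorem stub_rankBeatNormalForm :
    AutomaticPackingThesis ↔
      ∀ τ : ℝ, 2 / 3 < τ → ∃ (N R n : ℕ) (_ : 1 ≤ N) (_ : 1 ≤ R)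
        (A B C : Fin n → Finset (Fin R → ZMod N)),
        IsSTPP A B C ∧
          (3 : ℝ) ^ R * (N : ℝ) ^ R < ∑ i, (((A i).card * (B i).card * (C i).card : ℕ) : ℝ) ^ τ :=
  automaticPackingThesis_iff_rankBeat

end AutomaticPackingThesis

end Summit.MatrixMultiplication.MatrixMultiplication.Theorems

end
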